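/- Copyright: the b2b-balaban cell (near-miss cell 7), T⁴-continuum fan-out, lineage t4-ne7b-p1 (node U5c COUNT
member).  Released under the licence of the surrounding project. -/
import Summits.QuantumFields.BalabanUV.T4Continuum.Support.HistoryGenealogyInstantiateClauses

/-!
# INSTANTIATION FROM THE LEVEL SETS — SANITY (M3b-2, non-vacuity of the construction): a single new region at level
`0` IS the single live line of level `0`, its component's constituent list is `[inr n]`, and its extracted pedigree is
the birth (owner module of row NE7b, lineage `t4-ne7b-p1` gen 40, ruling R-OWNER-40-4; row S15 — PRE-POSITIONING ONLY)

Summits-side support leaf of the T⁴-continuum cell (rung (B)+1 on a FINITE torus only; NOT infinite volume, NOT the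
mass gap, NOT the Clay statement; NOT a proof of NE7b).  [folklore] finite combinatorics over bricks 2∕3 of M3b-2
(`tcomps`, `RunInput.St`, `hist`, brick 4's `constit_block_inr`) and row S13-R (`pgenR_zero_birth`); nothing printed
is asserted, zero `sorry`.  Purpose: a referee's check that `RunInput.St` is not vacuous (the blocks of a one-vertex
family are that vertex; `newLine` of a lone new region is the event line `(region, 0, region)`), in general form (any
`RunInput` with `N 0 = {n}`) — the process is noncomputable (chosen enumerations), so `decide` is not available.

WHAT IS PROVED.  `tcomp_singleton_vertex`, `tcomps_singleton` (the blocks of a one-member family); `vert_zero`,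
`blocks_zero_singleton`, `newLine_zero_inr`, **`St_zero_singleton`** (`I.N 0 = {n} → I.St 0 = {⟨n.2, 0, n.2⟩}`),
**`comp_zero_singleton`** (`I.hist.comp 0 = {(0, n.2)}`), **`constit_zero_singleton`** (`= [inr n]`),
**`pgenR_zero_singleton`** (`I.hist.pgenR I.rnw 0 (0, n.2) = birth 0 (I.cls n) n`).

HONEST.  Proves nothing of Bałaban's; NE7b NOT proved; spine 0∕9.  HONEST DEPENDENCY (cell): continuum YM on T⁴ ⇐
BetaPertH ∧ nine spine estimates (0/9 proved); BetaPertH ⇐ (D1) ∧ (D4) ∧ CAP+tail; G-an2-4 gates asym, D1 and NE2/3/4.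
This file changes none of it. -/

open Finset
open Literature.MathematicalPhysics.QuantumFieldTheory.Balaban1983to89
open Literature.MathematicalPhysics.QuantumFieldTheory.Balaban1983to89.B13ScaleTransfer
open Literature.MathematicalPhysics.QuantumFieldTheory.Balaban1983to89.B16MergeGeometry
open Summit.QuantumFields.BalabanUV.T4Continuum.HistoryAdmissible
open Summit.QuantumFields.BalabanUV.T4Continuum.HistoryGenealogyExtraction
open Summit.QuantumFields.BalabanUV.T4Continuum.HistoryGenealogyRealise
open Summit.QuantumFields.BalabanUV.T4Continuum.HistoryTouchComponents

namespace Summit.QuantumFields.BalabanUV.T4Continuum.HistoryGenealogyInstantiate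

noncomputable section

open Classical

variable {d : ℕ}

/-! ## §1 The blocks of a one-member family -/

/-- the block of the only member of a one-member family is that member [folklore] -/
theorem tcomp_singleton_vertex {ι : Type*} (P : ι → Finset (Pt d)) (v : ι) : tcomp P {v} v = {v} := by
  refine Finset.eq_singleton_iff_unique_mem.2 ⟨mem_tcomp_self (Finset.mem_singleton_self v), fun x hx => ?_⟩
  exact Finset.mem_singleton.1 (tcomp_subset v hx)

/-- the blocks of a one-member family: the one block [folklore] -/
theorem tcomps_singleton {ι : Type*} (P : ι → Finset (Pt d)) (v : ι) : tcomps P {v} = {{v}} := by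
  ext T
  rw [mem_tcomps_iff, Finset.mem_singleton]
  constructor
  · rintro ⟨i, hi, rfl⟩
    rw [Finset.mem_singleton] at hi
    subst hi
    exact tcomp_singleton_vertex P i
  · rintro rfl
    exact ⟨v, Finset.mem_singleton_self v, tcomp_singleton_vertex P v⟩

/-! ## §2 Level `0` with a single new region -/

namespace RunInput

variable (I : RunInput d) {n : Lab d} (hn : I.N 0 = {n})
include hn

/-- the vertices at level `0`: the one new region [folklore] -/
theorem vert_zero : I.vert 0 (I.Prev 0) = {Sum.inr n} := by
  simp [vert, Prev, hn]

/-- the blocks at level `0`: the one block [folklore] -/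
theorem blocks_zero_singleton : I.blocks 0 (I.Prev 0) = {{Sum.inr n}} := by
  rw [blocks, I.vert_zero hn, tcomps_singleton]

omit hn in
/-- the new line of a lone new region at level `0` is the event line `(region, 0, region)` [folklore] -/
theorem newLine_zero_inr (m : Lab d) : I.newLine 0 {Sum.inr m} = ⟨m.2, 0, m.2⟩ := by
  have hnone : I.loneOld 0 {Sum.inr m} = none := by
    by_contra h
    obtain ⟨τ, hτ⟩ := Option.ne_none_iff_exists'.1 h
    obtain ⟨hT, -⟩ := I.eq_of_loneOld_eq_some hτ
    have : (Sum.inr m : Line d ⊕ Lab d) ∈ ({Sum.inl τ} : Finset (Line d ⊕ Lab d)) := by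
      rw [← hT]; exact Finset.mem_singleton_self _
    simp at this
  unfold newLine
  rw [hnone]
  simp [P]

/-- **THE LIVE LINES AT LEVEL `0`**: the single new region, as the event line `(n.2, 0, n.2)`. [folklore] -/
theorem St_zero_singleton : I.St 0 = {⟨n.2, 0, n.2⟩} := by
  rw [St_eq_form, form, I.blocks_zero_singleton hn, Finset.image_singleton, I.newLine_zero_inr]

/-- the components of level `0`: the one label `(0, n.2)` [folklore] -/
theorem comp_zero_singleton : I.hist.comp 0 = {lab ⟨n.2, 0, n.2⟩} := by
  show (I.St 0).image lab = _
  rw [I.St_zero_singleton hn, Finset.image_singleton]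

/-- its constituent list: the one new region (under `NewOK`) [folklore] -/
theorem constit_zero_singleton (hN : I.NewOK) : I.hist.constit 0 (lab ⟨n.2, 0, n.2⟩) = [Sum.inr n] := by
  have hT : ({Sum.inr n} : Finset (Line d ⊕ Lab d)) ∈ I.blocks 0 (I.Prev 0) := by
    rw [I.blocks_zero_singleton hn]; exact Finset.mem_singleton_self _
  have hlab : lab (I.newLine 0 {Sum.inr n}) = lab (⟨n.2, 0, n.2⟩ : Line d) := by rw [I.newLine_zero_inr]
  rw [← hlab]
  exact I.constit_block_inr hN hT rfl

/-- **THE EXTRACTED PEDIGREE of the level-`0` component is the BIRTH of the region** (under `NewOK`). [folklore] -/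
theorem pgenR_zero_singleton (hN : I.NewOK) :
    I.hist.pgenR I.rnw 0 (lab ⟨n.2, 0, n.2⟩) = PGen.birth 0 (I.cls n) n :=
  I.hist.pgenR_zero_birth I.rnw _ _ (I.constit_zero_singleton hn hN)

end RunInput

end

end Summit.QuantumFields.BalabanUV.T4Continuum.HistoryGenealogyInstantiate
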